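import Summits.NavierStokesRegularity.NavierStokesRegularity.Theorems.OddMorawetzLocal.Negative.OddMorawetzLocalJetAlgebra

/-!
# Crux `OddMorawetzLocal` (stmt-NavierStokesRegularity-1376) — refutation vocabulary II: derivations, isotropic
fluxes, kernel pipelines

Definitions only (sequel to `OddMorawetzLocalJetAlgebra`), consumed by the refutation files of the line `registered`
(lead c1):
* `JPoly.derVar / der / derP / derMatrix` — the DERIVATION of jet polynomials induced by a `3 × 3` matrix `L`
  (the first-order term of the substitution action `act (1 + t L)`); for `L = lieZ` (the generator of the rotations
  about the third axis) a coefficient vector fixed by `O(3)` is killed by `derMatrix k lieZ` — the integer linear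
  system of the modular rank certificate;
* `isoFlux` / `isoFluxDiv` — the isotropic vector-valued fluxes of a shape (complete contractions with one free
  slot) and their divergences (null densities by construction), `contractionZ` (integer contraction densities),
  `IsoDesc` descriptors and `isoPoly` (descriptor ↦ integer jet polynomial);
* kernel pipelines (pure list functions, evaluated by `decide`): `minImage` (canonical signed image of a monomial),
  `e1Check` (orbit-sum identities on a range of basis monomials), `minorCols` / `matMulMod` / `isIdentityMod`
  (the block minors of the derivation matrix and their modular inverse check), `sCoords` (iso densities in orbit
  coordinates), `derKills` (the derivation kills a polynomial), `nfKills` (a polynomial is in the divergence-free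
  ideal).
Plain `def`s; nothing restates a tree notion.
-/

set_option linter.dupNamespace false
set_option autoImplicit false

namespace Summit.NavierStokesRegularity.NavierStokesRegularity.Theorems.OddMorawetz

namespace JPoly

variable {R : Type}

/-- The derivation induced by `L` on one variable: `∂^l v_a ↦ Σ_b L a b ∂^l v_b + Σ_s Σ_j L (l_s) j ∂^{l[s:=j]} v_a`
(the `t¹`-coefficient of `actVar (1 + t L)`). -/
def derVar [Mul R] [One R] (L : Matrix (Fin 3) (Fin 3) R) (v : JVar) : JPoly R :=
  ((List.finRange 3).map fun b => (L v.1 b, [(b, v.2)])) ++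
    (List.finRange v.2.length).flatMap fun s => (List.finRange 3).map fun j =>
      (L (v.2.getD s 0) j, [(v.1, sortIdx (v.2.set s j))])

/-- Zero-pruned twin of `derVar` (for `decide`). -/
def derVarP [Mul R] [One R] [Zero R] [DecidableEq R] (L : Matrix (Fin 3) (Fin 3) R) (v : JVar) : JPoly R :=
  (derVar L v).filter fun t => t.1 ≠ 0

/-- The derivation induced by `L` on polynomials (Leibniz over the variables of each monomial), output monomials
sorted. -/
def der [Mul R] [One R] (L : Matrix (Fin 3) (Fin 3) R) (p : JPoly R) : JPoly R :=
  p.flatMap fun t => (List.finRange t.2.length).flatMap fun s =>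
    (derVar L (t.2.getD s (0, []))).map fun cw => (t.1 * cw.1, sortVars (t.2.set s (cw.2.headD (0, []))))

/-- Zero-pruned twin of `der` (for `decide`). -/
def derP [Mul R] [One R] [Zero R] [DecidableEq R] (L : Matrix (Fin 3) (Fin 3) R) (p : JPoly R) : JPoly R :=
  p.flatMap fun t => (List.finRange t.2.length).flatMap fun s =>
    (derVarP L (t.2.getD s (0, []))).map fun cw => (t.1 * cw.1, sortVars (t.2.set s (cw.2.headD (0, []))))

end JPoly

/-- The matrix of the derivation induced by `L` on the monomial basis of weight `k`. -/
def derMatrix {R : Type} [Mul R] [One R] [Add R] [Zero R] (k : ℕ) (L : Matrix (Fin 3) (Fin 3) R) :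
    Matrix (Fin (idx k).length) (Fin (idx k).length) R :=
  Matrix.of fun i j => JPoly.coeffOf (JPoly.der L [(1, (idx k).get j)]) ((idx k).get i)

/-- The generator of the rotations about the third axis: `d/dθ R_θ |_{θ=0}` for `R_θ = ((c,-s,0),(s,c,0),(0,0,1))`. -/
def lieZ {R : Type} [Zero R] [One R] [Neg R] : Matrix (Fin 3) (Fin 3) R :=
  Matrix.of fun i j => if i = 0 ∧ j = 1 then -1 else if i = 1 ∧ j = 0 then 1 else 0

/-! ### Isotropic densities and fluxes from descriptors -/

/-- Integer contraction density (the landed `contractionOf` has natural-number coefficients in `ℚ`). -/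
def contractionZ (shape : List ℕ) (m : List ((ℕ × ℕ) × (ℕ × ℕ))) : JPoly ℤ :=
  (contractionOf shape m).map fun t => (t.1.num, t.2)

/-- The three components of the isotropic FLUX of a weight-`(k-1)` shape and a perfect matching of its slots together
with the free slot `(3, 0)` (the flux index): component `i` = sum over index assignments giving the free slot the
value `i` of the monomial of the real slots. -/
def isoFlux (shape : List ℕ) (m : List ((ℕ × ℕ) × (ℕ × ℕ))) (i : Fin 3) : JPoly ℤ :=
  let assignments : List (List (((ℕ × ℕ) × (ℕ × ℕ)) × Fin 3)) :=
    m.foldr (fun pr acc => (List.finRange 3).flatMap fun c => acc.map fun as => (pr, c) :: as) [[]]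
  let valueAt : List (((ℕ × ℕ) × (ℕ × ℕ)) × Fin 3) → ℕ × ℕ → Fin 3 := fun as s =>
    match as.find? (fun pc => pc.1.1 = s ∨ pc.1.2 = s) with
    | some pc => pc.2
    | none => 0
  (assignments.filter fun as => valueAt as (3, 0) == i).map fun as =>
    ((1 : ℤ), sortVars ((List.range shape.length).map fun t =>
      (valueAt as (t, 0), sortIdx ((List.range (shape.getD t 0)).map fun s => valueAt as (t, s + 1)))))

/-- The divergence of the isotropic flux (a null density by construction), collected. -/
def isoFluxDiv (shape : List ℕ) (m : List ((ℕ × ℕ) × (ℕ × ℕ))) : JPoly ℤ :=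
  JPoly.norm (JPoly.divergence (isoFlux shape m 0, isoFlux shape m 1, isoFlux shape m 2))

/-- Descriptor of an isotropic basis element: `dens` = contraction density, `null` = divergence of an isotropic
flux, `ideal` = contraction density with a self-contracted factor (vanishes on divergence-free jets), `poly` = an
explicit polynomial. -/
inductive IsoDesc
  | dens (shape : List ℕ) (m : List ((ℕ × ℕ) × (ℕ × ℕ)))
  | null (shape : List ℕ) (m : List ((ℕ × ℕ) × (ℕ × ℕ)))
  | ideal (shape : List ℕ) (m : List ((ℕ × ℕ) × (ℕ × ℕ)))
  | poly (p : JPoly ℤ)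

/-- The integer jet polynomial of a descriptor (normalised). -/
def isoPoly : IsoDesc → JPoly ℤ
  | .dens sh m => JPoly.norm (contractionZ sh m)
  | .null sh m => isoFluxDiv sh m
  | .ideal sh m => JPoly.norm (contractionZ sh m)
  | .poly p => JPoly.norm p

/-! ### Kernel pipelines -/

/-- The `monoCmp`-minimal signed image of a monomial under `B₃` (ties: first in `b3List`). -/
def minImage (m : List JVar) : ℤ × List JVar :=
  (b3List.map fun g => permAct g.1 g.2 m).foldl
    (fun best sw => match monoCmp sw.2 best.2 with | .lt => sw | _ => best) (1, m)

/-- The orbit-sum identities on the basis monomials `idx k [lo, lo + n)`: each `orbitSum ν` is an integer multiple of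
`orbitSumN` of the representative `minImage ν` when that is listed, and is zero otherwise. -/
def e1Check (k : ℕ) (reps : List (List JVar)) (lo n : ℕ) : Bool :=
  (List.range n).all fun t =>
    let ν := (idx k).getD (lo + t) []
    let o := orbitSum ν
    let rep := (minImage ν).2
    if reps.elem rep then
      match o.find? (fun tm => tm.2 = rep) with
      | none => false
      | some tm => decide (o = JPoly.smul tm.1 (orbitSumN rep))
    else o.isEmpty

/-- The columns of a block minor of the derivation matrix on orbit sums: for the listed representative indices
`cs`, the coefficients of `derP L (orbitSumN rep)` at the listed basis rows `rs`, reduced mod `p`. -/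
def minorCols (k : ℕ) (L : Matrix (Fin 3) (Fin 3) ℤ) (reps : List (List JVar)) (rs cs : List ℕ) (p : ℕ) :
    List (List ℕ) :=
  cs.map fun c =>
    let col := JPoly.derP L (orbitSumN (reps.getD c []))
    rs.map fun i => Int.toNat ((JPoly.coeffOf col ((idx k).getD i [])) % (p : ℤ))

/-- Matrix product mod `p` of (rows of `M`) × (columns `Bcols`), both as lists; entry `(i, j) = Σ_t M i t * B t j`. -/
def matMulMod (Mrows : List (List ℕ)) (Bcols : List (List ℕ)) (p : ℕ) : List (List ℕ) :=
  Mrows.map fun row => Bcols.map fun col => (List.zipWith (· * ·) row col).foldr (fun x acc => (x + acc) % p) 0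

/-- Is a square list-matrix the identity? -/
def isIdentityList (M : List (List ℕ)) : Bool :=
  (List.range M.length).all fun i => (List.range M.length).all fun j =>
    (M.getD i []).getD j 0 = (if i = j then 1 else 0)

/-- Transpose of a list-of-columns into a list-of-rows (all of length `n`). -/
def colsToRows (cols : List (List ℕ)) (n : ℕ) : List (List ℕ) :=
  (List.range n).map fun i => cols.map fun c => c.getD i 0

/-- The modular check of one block certificate: `minor * inv = 1 (mod p)` with the minor computed from `derP`. -/
def blockCheck (k : ℕ) (L : Matrix (Fin 3) (Fin 3) ℤ) (reps : List (List JVar)) (rs cs : List ℕ)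
    (inv : List (List ℕ)) (p : ℕ) : Bool :=
  let rows := colsToRows (minorCols k L reps rs cs p) rs.length
  let invCols := colsToRows inv inv.length  -- `inv` is given by rows; its columns
  isIdentityList (matMulMod rows invCols p)

/-- Coordinates of a polynomial in the orbit basis: the coefficient at each listed representative. -/
def sCoords (reps : List (List JVar)) (q : JPoly ℤ) : List ℤ := reps.map fun m => JPoly.coeffOf q m

/-- Does the derivation of `L` kill the polynomial? -/
def derKills (L : Matrix (Fin 3) (Fin 3) ℤ) (q : JPoly ℤ) : Bool := JPoly.isZero (JPoly.derP L q)

/-- Is the polynomial in the divergence-free ideal (normal form zero)? -/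
def nfKills (q : JPoly ℤ) : Bool := JPoly.isZero (JPoly.nf q)

/-- Reconstruction check: a polynomial equals the combination of normalised orbit sums given by its orbit
coordinates (i.e. it is `B₃`-symmetric and supported on non-self-cancelling orbits). -/
def orbitRecon (reps : List (List JVar)) (q : JPoly ℤ) : Bool :=
  decide (JPoly.norm q = JPoly.norm (reps.flatMap fun m => JPoly.smul (JPoly.coeffOf q m) (orbitSumN m)))

end Summit.NavierStokesRegularity.NavierStokesRegularity.Theorems.OddMorawetz
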